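import Summits.NavierStokesRegularity.FluidComputer.PalasekTowerRegisterGlobalHalves
import Summits.NavierStokesRegularity.FluidComputer.PalasekTowerHeredityWitnessUnconditional

/-!
# REGISTER v2.3′: the two halves of heredity AT EACH LEVEL — `HeredityAt k ↔ ContinuationEnvelopeAt k ∧ ReadoutFloorsAt k`,
# every `k`, no hypothesis; in particular the first rung `HeredityAtOne` (item 19249) splits losslessly

Cell `ns-blowup`, seat `ns-blowup-ecbridge-7` (literature-prover; D-0074 GROUP C «BRIDGE SUPPORT»;
director-ns RE-POINT 2026-08-26T03:36:55Z; bears_on LADDER-NS N1, route `PalasekTowerBreakdown`,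
child crux item stmt-NavierStokesRegularity-19249 `HeredityAtOne` — supported, NOT closed or
claimed). Companion of `PalasekTowerRegisterGlobalHeredity.lean` (p415576: `HeredityAt k`,
`HeredityAtOne = HeredityAt 1`, and the two halves `ContinuationEnvelope` / `ReadoutFloors` of the
planner's BC3 skeleton, typed for the GENERIC levels `k ≥ 2` only), of
`PalasekTowerRegisterGlobalHalves.lean` (ecbridge-5, p419350: at `k ≥ 2` the split is lossless by
silent-window uniqueness, `heredityFrom_two_iff_envelope_and_floors`) and of
`PalasekTowerHeredityWitnessUnconditional.lean` (ecbridge-6 g2: a continuation carrying the next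
ceiling is THE flow of the design, `Stage.velocity_eq_of_window_ceiling` — forced Serrin–Masuda
weak–strong uniqueness, a THEOREM of the tree; no W14). LABEL: E–C typing (KERNEL: two level-indexed
`@[conjecture]` predicates — the bodies of the halves of record at a fixed level, nothing new is
asserted — and PROVED equivalences). WHAT THIS IS NOT: not Navier–Stokes evidence — no stage, flow
or tower is constructed or claimed; `HeredityAt k`, `ContinuationEnvelopeAt k`, `ReadoutFloorsAt k`
are OPEN statements appearing only inside equivalences / implications.

## What is typed and proved

* §1 `ContinuationEnvelopeAt k` / `ReadoutFloorsAt k`: the UPPER half (every globally anchored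
  registered stage at level `k` of a pinned rigid quiet wide design continues classically, with
  finite energy, to `τ (k+1)` inside the ceiling `c₂ Y_{k+1}` — no premature blow-up, no overshoot)
  and the LOWER half (every such finite-energy continuation inside the ceiling shows at `τ (k+1)`,
  in the ball, the three floors of level `k + 1`) AT ONE LEVEL `k` — the bodies of p415576's
  `ContinuationEnvelope` / `ReadoutFloors` with the quantifier `∀ k ≥ 2` removed;
  `continuationEnvelope_iff_forall_at`, `readoutFloors_iff_forall_at` (the halves of record are
  these at all `k ≥ 2`).
* §2 **The split is LOSSLESS at EVERY level, with NO hypothesis**: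
  `heredityAt_iff_envelopeAt_and_floorsAt : HeredityAt k ↔ ContinuationEnvelopeAt k ∧ ReadoutFloorsAt k`.
  `⇐` is the BC3 assembly `Stage.nonempty_extends_of_continuation`; `⇒` for the upper half is the
  extension stage itself; `⇒` for the LOWER half needs that an arbitrary finite-energy continuation
  INSIDE THE CEILING coincides with the extension stage's flow — at `k ≥ 2` ecbridge-5 had this from
  the silent window, at `k ≤ 1` (comparison from `t = 0` through the forced era `[0, τ₁)`) it is
  ecbridge-6 g2's `Stage.velocity_eq_of_window_ceiling` (the ceiling makes the continuation the
  bounded = strong solution; forced Serrin–Masuda). So at the first rung: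
  **`heredityAtOne_iff_envelopeAt_and_floorsAt : HeredityAtOne ↔ ContinuationEnvelopeAt 1 ∧ ReadoutFloorsAt 1`**
  — item 19249 decomposes exactly like its sibling 19250 (`HeredityFrom 2 ↔ ContinuationEnvelope ∧
  ReadoutFloors`), into «the level-1 flow survives the first unforced window `[τ₁, τ₂]` below
  `(5/3)·Y₂` with finite energy» and «at `τ₂` it shows speed `≥ Y₂`, strain `≥ A₂` and the `N₂`-core
  in the ball»; a refutation of either half refutes the item, a proof of both proves it.
* §3 **The lower half may be asked of ONE continuation per stage** (`ReadoutFloorsAt.of_exists`): if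
  every registered level-`k` stage has SOME finite-energy classical continuation to `τ (k+1)` inside
  the ceiling meeting the three floors, `ReadoutFloorsAt k` holds (the floors transfer to every other
  finite-energy continuation by `velocity_eq_of_window_ceiling`) — and then so does `HeredityAt k`
  (`heredityAt_of_exists_velocity_continuation`, the unbundled «runs ∧ letter» form of the gate at
  level `k` with VELOCITY agreement only — companion of p419726's `heredityAt_iff_exists_continuation`,
  which asks pressure agreement too).
* §4 interlocks: `HeredityFrom k₀ ↔ ∀ k ≥ k₀, ContinuationEnvelopeAt k ∧ ReadoutFloorsAt k`;
  `EpisodeInductionG ↔ (ContinuationEnvelopeAt 1 ∧ ReadoutFloorsAt 1) ∧ ContinuationEnvelope ∧ ReadoutFloors`.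

References: S. Palasek, arXiv:2605.13827 §4 [cite: Palasek2026ElementaryModel, §4]; H. Sohr, *The
Navier–Stokes Equations*, Birkhäuser 2001, Ch. V Thm. 1.5.1 [cite: Sohr2001, Ch. V Thm. 1.5.1].
-/

noncomputable section

namespace Summit.NavierStokesRegularity.FluidComputer.PalasekTowerClayBridge

open Set MeasureTheory Filter Topology Function Real
open scoped ENNReal ContDiff NNReal
open Literature.Analysis.FluidPDE
open Summit.NavierStokesRegularity.NavierStokesRegularity

/-! ## §1 The two halves at ONE level -/

/-- **UPPER half AT level `k` — the continuation envelope of the hand-over `k → k+1`** (open; never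
asserted): every globally anchored registered stage at level `k` of a pinned (`Λ = 8`, `θ = 6/5`),
rigid, quiet schedule on the wide-base rates continues as a classical solution (force `S.f`, which
vanishes after `τ 1`) to the next readout `τ (k+1)`, with finite energy on `[0, τ (k+1)]` and inside
the next ceiling `c₂ Y_{k+1}` there — no premature blow-up, no overshoot. At `k = 1`: the level-1 flow
survives the first unforced window `[τ₁, τ₂]` (length `(253/25) log N₂ / A₁`) below `(5/3)·Y₂`. The body
of p415576's `ContinuationEnvelope` at a fixed level. [cite: Palasek2026ElementaryModel, §4] -/
@[conjecture] def ContinuationEnvelopeAt (k : ℕ) : Prop :=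
  ∀ S : Schedule TowerRates.wide, S.Pins 8 (6 / 5) → S.Rigid → S.Quiet →
    ∀ s : Stage 1 TowerRates.wide S (Margins.routeG TowerRates.wide) k,
      ∃ (u : ℝ → EuclideanSpace ℝ (Fin 3) → EuclideanSpace ℝ (Fin 3))
        (p : ℝ → EuclideanSpace ℝ (Fin 3) → ℝ),
        IsClassicalNSSolutionOn (Icc 0 (S.τ (k + 1))) 1 S.f u p ∧
        (∀ t ∈ Icc 0 (S.τ k), u t = s.u t ∧ p t = s.p t) ∧
        (∃ C : ℝ≥0∞, C < ⊤ ∧ ∀ t ∈ Icc 0 (S.τ (k + 1)), ∫⁻ x, ‖u t x‖ₑ ^ 2 ≤ C) ∧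
        (∀ t ∈ Icc 0 (S.τ (k + 1)), ∀ x, ‖u t x‖ ≤ S.c₂ * TowerRates.wide.Y (k + 1))

/-- **LOWER half AT level `k` — the readout floors of the hand-over `k → k+1`** (open; never
asserted): for every pinned, rigid, quiet wide schedule, every globally anchored registered stage at
level `k` and EVERY classical finite-energy continuation of it to `τ (k+1)` inside the next ceiling,
the three floors of level `k + 1` hold at `τ (k+1)` inside the ball: speed `≥ c₁ Y_{k+1}` somewhere,
strain `≥ c₁ A_{k+1}` somewhere, and the core ledger (a `C¹` loop of speed `≤ 8π/N_{k+1}` in a ball of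
radius `1/N_{k+1}` with circulation `≥ c₁ N_{k+1}^{β-2}`). At `k = 1`: at `τ₂`, speed `≥ Y₂`, strain
`≥ A₂`, the `N₂`-core. The body of p415576's `ReadoutFloors` at a fixed level.
[cite: Palasek2026ElementaryModel, §4] -/
@[conjecture] def ReadoutFloorsAt (k : ℕ) : Prop :=
  ∀ S : Schedule TowerRates.wide, S.Pins 8 (6 / 5) → S.Rigid → S.Quiet →
    ∀ s : Stage 1 TowerRates.wide S (Margins.routeG TowerRates.wide) k,
    ∀ (u : ℝ → EuclideanSpace ℝ (Fin 3) → EuclideanSpace ℝ (Fin 3))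
      (p : ℝ → EuclideanSpace ℝ (Fin 3) → ℝ),
      IsClassicalNSSolutionOn (Icc 0 (S.τ (k + 1))) 1 S.f u p →
      (∀ t ∈ Icc 0 (S.τ k), u t = s.u t ∧ p t = s.p t) →
      (∃ C : ℝ≥0∞, C < ⊤ ∧ ∀ t ∈ Icc 0 (S.τ (k + 1)), ∫⁻ x, ‖u t x‖ₑ ^ 2 ≤ C) →
      (∀ t ∈ Icc 0 (S.τ (k + 1)), ∀ x, ‖u t x‖ ≤ S.c₂ * TowerRates.wide.Y (k + 1)) →
      (∃ x, ‖x‖ ≤ S.radius ∧ S.c₁ * TowerRates.wide.Y (k + 1) ≤ ‖u (S.τ (k + 1)) x‖) ∧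
      (∃ x, ‖x‖ ≤ S.radius ∧
        S.c₁ * TowerRates.wide.A (k + 1) ≤ ‖fderiv ℝ (u (S.τ (k + 1))) x‖) ∧
      (∃ (x : EuclideanSpace ℝ (Fin 3)) (γ : ℝ → EuclideanSpace ℝ (Fin 3)),
        ‖x‖ ≤ S.radius ∧ ContDiff ℝ 1 γ ∧ γ 0 = γ 1 ∧
        (∀ σ ∈ Icc (0 : ℝ) 1, γ σ ∈ Metric.closedBall x (1 / TowerRates.wide.N (k + 1))) ∧
        (∀ σ ∈ Icc (0 : ℝ) 1, ‖deriv γ σ‖ ≤ 8 * π / TowerRates.wide.N (k + 1)) ∧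
        S.c₁ * TowerRates.wide.N (k + 1) ^ (TowerRates.wide.β - 2) ≤
          circulation (u (S.τ (k + 1))) γ)

/-- The upper half of record IS the level-wise upper half at every `k ≥ 2`. [folklore] -/
theorem continuationEnvelope_iff_forall_at :
    ContinuationEnvelope ↔ ∀ k : ℕ, 2 ≤ k → ContinuationEnvelopeAt k :=
  ⟨fun h k hk S hP hR hQ s => h S hP hR hQ k hk s, fun h S hP hR hQ k hk s => h k hk S hP hR hQ s⟩

/-- The lower half of record IS the level-wise lower half at every `k ≥ 2`. [folklore] -/
theorem readoutFloors_iff_forall_at : ReadoutFloors ↔ ∀ k : ℕ, 2 ≤ k → ReadoutFloorsAt k :=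
  ⟨fun h k hk S hP hR hQ s => h S hP hR hQ k hk s, fun h S hP hR hQ k hk s => h k hk S hP hR hQ s⟩

/-! ## §2 The split is lossless at every level, with no hypothesis -/

/-- **Heredity at level `k` gives the upper half at level `k`** (free: the extension stage is a
finite-energy classical continuation inside its own level-`k+1` ceiling). [folklore] -/
theorem HeredityAt.continuationEnvelopeAt {k : ℕ} (h : HeredityAt k) : ContinuationEnvelopeAt k := by
  intro S hP hR hQ s
  obtain ⟨s', hs'⟩ := h S hP hR hQ s
  exact ⟨s'.u, s'.p, s'.classical, hs', s'.energy, fun t ht x => s'.ceiling (k + 1) le_rfl t ht x⟩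

/-- **Heredity at level `k` gives the LOWER half at level `k` — every `k`, no W14.** Given a
registered stage `s` at level `k` and ANY finite-energy classical continuation `(u, p)` of it to
`τ (k+1)` inside the ceiling, the extension stage `s'` provided by heredity is a finite-energy
classical flow of the design from the Clay datum carrying the window ceiling, so `u = s'.u` on
`[0, τ (k+1)]` by `Stage.velocity_eq_of_window_ceiling` (forced Serrin–Masuda; at `k ≤ 1` the
comparison runs through the forced era, where the silent-window argument of
`ReadoutFloors.of_heredityFrom_two` is unavailable), and the three floors of level `k + 1` are read
off `s'` at `τ (k+1)`. [cite: Sohr2001, Ch. V Thm. 1.5.1] -/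
theorem HeredityAt.readoutFloorsAt {k : ℕ} (h : HeredityAt k) : ReadoutFloorsAt k := by
  intro S hP hR hQ s u p hcl hagree henergy hceil
  obtain ⟨s', hs'⟩ := h S hP hR hQ s
  have h0 : (0 : ℝ) ∈ Icc 0 (S.τ k) := ⟨le_rfl, (S.τ_pos k).le⟩
  have hu0 : u 0 = S.u₀ := ((hagree 0 h0).1).trans s.initial
  have hceil' : ∀ t ∈ Icc (S.τ k) (S.τ (k + 1)), ∀ x, ‖s'.u t x‖ ≤ S.c₂ * TowerRates.wide.Y (k + 1) :=
    fun t ht x => s'.ceiling (k + 1) le_rfl t ⟨(S.τ_pos k).le.trans ht.1, ht.2⟩ x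
  have heq : ∀ t ∈ Icc 0 (S.τ (k + 1)), u t = s'.u t :=
    s.velocity_eq_of_window_ceiling one_pos s'.classical s'.initial s'.energy hceil' hcl hu0 henergy
  have hτ : S.τ (k + 1) ∈ Icc 0 (S.τ (k + 1)) := ⟨(S.τ_pos (k + 1)).le, le_rfl⟩
  rw [heq (S.τ (k + 1)) hτ]
  exact ⟨s'.floor (k + 1) le_rfl, s'.routeG_strain (k + 1) le_rfl, s'.routeG_coreLedger (k + 1) le_rfl⟩

/-- **The two halves at level `k` give heredity at level `k`** (the BC3 assembly
`Stage.nonempty_extends_of_continuation`, any `k`). [folklore] -/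
theorem heredityAt_of_envelopeAt_floorsAt {k : ℕ} (hA : ContinuationEnvelopeAt k)
    (hB : ReadoutFloorsAt k) : HeredityAt k := by
  intro S hP hR hQ s
  obtain ⟨u, p, hcl, hagree, henergy, hceil⟩ := hA S hP hR hQ s
  obtain ⟨hfloor, hstrain, hcore⟩ := hB S hP hR hQ s u p hcl hagree henergy hceil
  exact s.nonempty_extends_of_continuation hR hcl hagree henergy hceil hfloor hstrain hcore

/-- **THE SPLIT IS LOSSLESS AT EVERY LEVEL, NO HYPOTHESIS**: heredity at level `k` ⇔ upper half at
`k` ∧ lower half at `k`. [cite: Sohr2001, Ch. V Thm. 1.5.1] -/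
theorem heredityAt_iff_envelopeAt_and_floorsAt {k : ℕ} :
    HeredityAt k ↔ ContinuationEnvelopeAt k ∧ ReadoutFloorsAt k :=
  ⟨fun h => ⟨h.continuationEnvelopeAt, h.readoutFloorsAt⟩,
    fun h => heredityAt_of_envelopeAt_floorsAt h.1 h.2⟩

/-- **THE FIRST RUNG SPLITS LOSSLESSLY — `HeredityAtOne ↔ ContinuationEnvelopeAt 1 ∧ ReadoutFloorsAt 1`,
no hypothesis** (item stmt-NavierStokesRegularity-19249 = «the level-1 flow survives the first
unforced window below `(5/3)·Y₂` with finite energy» ∧ «at `τ₂` it shows speed `≥ Y₂`, strain `≥ A₂`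
and the `N₂`-core in the ball»). [cite: Sohr2001, Ch. V Thm. 1.5.1] -/
theorem heredityAtOne_iff_envelopeAt_and_floorsAt :
    HeredityAtOne ↔ ContinuationEnvelopeAt 1 ∧ ReadoutFloorsAt 1 :=
  heredityAtOne_iff.trans heredityAt_iff_envelopeAt_and_floorsAt

/-- The first rung from its two halves (the composition a BC3 line on item 19249 would register).
[folklore] -/
theorem heredityAtOne_of_envelopeAt_floorsAt (hA : ContinuationEnvelopeAt 1) (hB : ReadoutFloorsAt 1) :
    HeredityAtOne :=
  heredityAtOne_iff_envelopeAt_and_floorsAt.2 ⟨hA, hB⟩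

/-- The first rung yields its upper half. [folklore] -/
theorem HeredityAtOne.continuationEnvelopeAt (h : HeredityAtOne) : ContinuationEnvelopeAt 1 :=
  (heredityAtOne_iff_envelopeAt_and_floorsAt.1 h).1

/-- The first rung yields its lower half (no W14). [cite: Sohr2001, Ch. V Thm. 1.5.1] -/
theorem HeredityAtOne.readoutFloorsAt (h : HeredityAtOne) : ReadoutFloorsAt 1 :=
  (heredityAtOne_iff_envelopeAt_and_floorsAt.1 h).2

/-! ## §3 The lower half may be asked of ONE continuation per stage -/

/-- **ONE good continuation per stage gives the lower half at level `k` — every `k`, no W14.** If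
every registered level-`k` stage of a pinned rigid quiet wide design has SOME finite-energy classical
continuation to `τ (k+1)` inside the ceiling `c₂ Y_{k+1}` that meets the three floors of level
`k + 1` at `τ (k+1)`, then `ReadoutFloorsAt k`: any other finite-energy continuation coincides with
it on `[0, τ (k+1)]` (`Stage.velocity_eq_of_window_ceiling`). The cheaper signature for a support
item on the lower half. [cite: Sohr2001, Ch. V Thm. 1.5.1] -/
theorem ReadoutFloorsAt.of_exists {k : ℕ}
    (h : ∀ S : Schedule TowerRates.wide, S.Pins 8 (6 / 5) → S.Rigid → S.Quiet →
      ∀ s : Stage 1 TowerRates.wide S (Margins.routeG TowerRates.wide) k,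
        ∃ (v : ℝ → EuclideanSpace ℝ (Fin 3) → EuclideanSpace ℝ (Fin 3))
          (q : ℝ → EuclideanSpace ℝ (Fin 3) → ℝ),
          IsClassicalNSSolutionOn (Icc 0 (S.τ (k + 1))) 1 S.f v q ∧
          (∀ t ∈ Icc 0 (S.τ k), v t = s.u t) ∧
          (∃ C : ℝ≥0∞, C < ⊤ ∧ ∀ t ∈ Icc 0 (S.τ (k + 1)), ∫⁻ x, ‖v t x‖ₑ ^ 2 ≤ C) ∧
          (∀ t ∈ Icc 0 (S.τ (k + 1)), ∀ x, ‖v t x‖ ≤ S.c₂ * TowerRates.wide.Y (k + 1)) ∧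
          (∃ x, ‖x‖ ≤ S.radius ∧ S.c₁ * TowerRates.wide.Y (k + 1) ≤ ‖v (S.τ (k + 1)) x‖) ∧
          (∃ x, ‖x‖ ≤ S.radius ∧
            S.c₁ * TowerRates.wide.A (k + 1) ≤ ‖fderiv ℝ (v (S.τ (k + 1))) x‖) ∧
          (∃ (x : EuclideanSpace ℝ (Fin 3)) (γ : ℝ → EuclideanSpace ℝ (Fin 3)),
            ‖x‖ ≤ S.radius ∧ ContDiff ℝ 1 γ ∧ γ 0 = γ 1 ∧
            (∀ σ ∈ Icc (0 : ℝ) 1, γ σ ∈ Metric.closedBall x (1 / TowerRates.wide.N (k + 1))) ∧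
            (∀ σ ∈ Icc (0 : ℝ) 1, ‖deriv γ σ‖ ≤ 8 * π / TowerRates.wide.N (k + 1)) ∧
            S.c₁ * TowerRates.wide.N (k + 1) ^ (TowerRates.wide.β - 2) ≤
              circulation (v (S.τ (k + 1))) γ)) :
    ReadoutFloorsAt k := by
  intro S hP hR hQ s u p hcl hagree henergy hceil
  obtain ⟨v, q, hvcl, hvagree, hvenergy, hvceil, hfloor, hstrain, hcore⟩ := h S hP hR hQ s
  have h0 : (0 : ℝ) ∈ Icc 0 (S.τ k) := ⟨le_rfl, (S.τ_pos k).le⟩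
  have hu0 : u 0 = S.u₀ := ((hagree 0 h0).1).trans s.initial
  have hv0 : v 0 = S.u₀ := (hvagree 0 h0).trans s.initial
  have heq : ∀ t ∈ Icc 0 (S.τ (k + 1)), u t = v t :=
    s.velocity_eq_of_window_ceiling one_pos hvcl hv0 hvenergy (fun t ht x => hvceil t
      ⟨(S.τ_pos k).le.trans ht.1, ht.2⟩ x) hcl hu0 henergy
  have hτ : S.τ (k + 1) ∈ Icc 0 (S.τ (k + 1)) := ⟨(S.τ_pos (k + 1)).le, le_rfl⟩
  rw [heq (S.τ (k + 1)) hτ]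
  exact ⟨hfloor, hstrain, hcore⟩

/-- **The unbundled gate at level `k`** («runs ∧ letter», no hypothesis): heredity at level `k`
holds iff every registered level-`k` stage has SOME finite-energy classical continuation to
`τ (k+1)` agreeing with it in velocity, inside the ceiling and meeting the three floors — the
pressure gauge is free (`Stage.exists_extends_of_velocity_continuation`). [folklore] -/
theorem heredityAt_iff_exists_velocity_continuation {k : ℕ} :
    HeredityAt k ↔
      ∀ S : Schedule TowerRates.wide, S.Pins 8 (6 / 5) → S.Rigid → S.Quiet →
        ∀ s : Stage 1 TowerRates.wide S (Margins.routeG TowerRates.wide) k,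
          ∃ (v : ℝ → EuclideanSpace ℝ (Fin 3) → EuclideanSpace ℝ (Fin 3))
            (q : ℝ → EuclideanSpace ℝ (Fin 3) → ℝ),
            IsClassicalNSSolutionOn (Icc 0 (S.τ (k + 1))) 1 S.f v q ∧
            (∀ t ∈ Icc 0 (S.τ k), v t = s.u t) ∧
            (∃ C : ℝ≥0∞, C < ⊤ ∧ ∀ t ∈ Icc 0 (S.τ (k + 1)), ∫⁻ x, ‖v t x‖ₑ ^ 2 ≤ C) ∧
            (∀ t ∈ Icc 0 (S.τ (k + 1)), ∀ x, ‖v t x‖ ≤ S.c₂ * TowerRates.wide.Y (k + 1)) ∧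
            (∃ x, ‖x‖ ≤ S.radius ∧ S.c₁ * TowerRates.wide.Y (k + 1) ≤ ‖v (S.τ (k + 1)) x‖) ∧
            (∃ x, ‖x‖ ≤ S.radius ∧
              S.c₁ * TowerRates.wide.A (k + 1) ≤ ‖fderiv ℝ (v (S.τ (k + 1))) x‖) ∧
            (∃ (x : EuclideanSpace ℝ (Fin 3)) (γ : ℝ → EuclideanSpace ℝ (Fin 3)),
              ‖x‖ ≤ S.radius ∧ ContDiff ℝ 1 γ ∧ γ 0 = γ 1 ∧
              (∀ σ ∈ Icc (0 : ℝ) 1, γ σ ∈ Metric.closedBall x (1 / TowerRates.wide.N (k + 1))) ∧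
              (∀ σ ∈ Icc (0 : ℝ) 1, ‖deriv γ σ‖ ≤ 8 * π / TowerRates.wide.N (k + 1)) ∧
              S.c₁ * TowerRates.wide.N (k + 1) ^ (TowerRates.wide.β - 2) ≤
                circulation (v (S.τ (k + 1))) γ) := by
  constructor
  · intro h S hP hR hQ s
    obtain ⟨s', hs'⟩ := h S hP hR hQ s
    exact ⟨s'.u, s'.p, s'.classical, fun t ht => (hs' t ht).1, s'.energy,
      fun t ht x => s'.ceiling (k + 1) le_rfl t ht x, s'.floor (k + 1) le_rfl,
      s'.routeG_strain (k + 1) le_rfl, s'.routeG_coreLedger (k + 1) le_rfl⟩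
  · intro h S hP hR hQ s
    obtain ⟨v, q, hcl, hvel, henergy, hceil, hfloor, hstrain, hcore⟩ := h S hP hR hQ s
    exact s.exists_extends_of_velocity_continuation hcl hvel henergy
      (fun t ht x => hceil t ⟨(S.τ_pos k).le.trans ht.1, ht.2⟩ x) hfloor hstrain hcore

/-- Hence ONE good continuation per stage gives heredity at the level outright (both halves at
once). [folklore] -/
theorem heredityAt_of_exists_velocity_continuation {k : ℕ}
    (h : ∀ S : Schedule TowerRates.wide, S.Pins 8 (6 / 5) → S.Rigid → S.Quiet →
      ∀ s : Stage 1 TowerRates.wide S (Margins.routeG TowerRates.wide) k,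
        ∃ (v : ℝ → EuclideanSpace ℝ (Fin 3) → EuclideanSpace ℝ (Fin 3))
          (q : ℝ → EuclideanSpace ℝ (Fin 3) → ℝ),
          IsClassicalNSSolutionOn (Icc 0 (S.τ (k + 1))) 1 S.f v q ∧
          (∀ t ∈ Icc 0 (S.τ k), v t = s.u t) ∧
          (∃ C : ℝ≥0∞, C < ⊤ ∧ ∀ t ∈ Icc 0 (S.τ (k + 1)), ∫⁻ x, ‖v t x‖ₑ ^ 2 ≤ C) ∧
          (∀ t ∈ Icc 0 (S.τ (k + 1)), ∀ x, ‖v t x‖ ≤ S.c₂ * TowerRates.wide.Y (k + 1)) ∧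
          (∃ x, ‖x‖ ≤ S.radius ∧ S.c₁ * TowerRates.wide.Y (k + 1) ≤ ‖v (S.τ (k + 1)) x‖) ∧
          (∃ x, ‖x‖ ≤ S.radius ∧
            S.c₁ * TowerRates.wide.A (k + 1) ≤ ‖fderiv ℝ (v (S.τ (k + 1))) x‖) ∧
          (∃ (x : EuclideanSpace ℝ (Fin 3)) (γ : ℝ → EuclideanSpace ℝ (Fin 3)),
            ‖x‖ ≤ S.radius ∧ ContDiff ℝ 1 γ ∧ γ 0 = γ 1 ∧
            (∀ σ ∈ Icc (0 : ℝ) 1, γ σ ∈ Metric.closedBall x (1 / TowerRates.wide.N (k + 1))) ∧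
            (∀ σ ∈ Icc (0 : ℝ) 1, ‖deriv γ σ‖ ≤ 8 * π / TowerRates.wide.N (k + 1)) ∧
            S.c₁ * TowerRates.wide.N (k + 1) ^ (TowerRates.wide.β - 2) ≤
              circulation (v (S.τ (k + 1))) γ)) :
    HeredityAt k :=
  heredityAt_iff_exists_velocity_continuation.2 h

/-! ## §4 Interlocks with the statements of record -/

/-- Heredity from `k₀` ⇔ both halves at every level `k ≥ k₀` — no hypothesis. [folklore] -/
theorem heredityFrom_iff_forall_envelopeAt_and_floorsAt {k₀ : ℕ} :
    HeredityFrom k₀ ↔ ∀ k : ℕ, k₀ ≤ k → ContinuationEnvelopeAt k ∧ ReadoutFloorsAt k :=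
  ⟨fun h _ hk => heredityAt_iff_envelopeAt_and_floorsAt.1 (h.heredityAt hk),
    fun h S hP hR hQ k hk s => (heredityAt_iff_envelopeAt_and_floorsAt.2 (h k hk)) S hP hR hQ s⟩

/-- The halves of record are the level-wise halves at all `k ≥ 2`, jointly: `ContinuationEnvelope ∧
ReadoutFloors ↔ ∀ k ≥ 2, ContinuationEnvelopeAt k ∧ ReadoutFloorsAt k`. [folklore] -/
theorem envelope_and_floors_iff_forall_at :
    ContinuationEnvelope ∧ ReadoutFloors ↔
      ∀ k : ℕ, 2 ≤ k → ContinuationEnvelopeAt k ∧ ReadoutFloorsAt k := by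
  rw [continuationEnvelope_iff_forall_at, readoutFloors_iff_forall_at]
  exact ⟨fun h k hk => ⟨h.1 k hk, h.2 k hk⟩, fun h => ⟨fun k hk => (h k hk).1, fun k hk => (h k hk).2⟩⟩

/-- **K2G in four halves, no hypothesis**: `EpisodeInductionG ↔ (ContinuationEnvelopeAt 1 ∧
ReadoutFloorsAt 1) ∧ ContinuationEnvelope ∧ ReadoutFloors` (the first rung split here, the generic
levels by ecbridge-5's `episodeInductionG_iff_rung_envelope_floors`). [cite: Sohr2001, Ch. V Thm. 1.5.1] -/
theorem episodeInductionG_iff_halves :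
    EpisodeInductionG ↔
      (ContinuationEnvelopeAt 1 ∧ ReadoutFloorsAt 1) ∧ ContinuationEnvelope ∧ ReadoutFloors := by
  rw [episodeInductionG_iff_rung_envelope_floors, heredityAtOne_iff_envelopeAt_and_floorsAt]

end Summit.NavierStokesRegularity.FluidComputer.PalasekTowerClayBridge

end
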